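import Literature.AlgebraicGeometry.AbelianSchemes.IsLambdaOfAtAlongDualIsogeny
import Literature.AlgebraicGeometry.AbelianSchemes.AbelianSchemeQuotientMulNDescent
import HarnessLib

/-!
# The pulled-back witness `Θ₀ := π_s^*Θ′`: `Λ(𝒪(π_s^*Θ′)) = π ≫ λ′ ≫ π^∨`, hence `= λ_B^c` under the isogeny identity

Layer `Literature/AlgebraicGeometry/AbelianSchemes`, namespace `Literature.AlgebraicGeometry.AbelianSchemes.AbelianSchemeOver`.
THEOREMS ONLY (no definition, no named fact, no instance, no `sorry`).  Cell `hodgecm-mathlib` (D-0151), HECKE-LINK brick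
(X-amp-2) (B-plan1 (g14) 22:05Z; binder (h2) of B-p15's (X-amp-3) assembly «Bezout ⇒ `polB.exists_ample`»; count-neutral):
for an isogeny `π : B → A′` of abelian schemes over `S` with dual `π^∨ = DualPair.dualIsogenyOver π DB D′` (★ `AbelianSchemeDualIsogeny`),
a witness `Θ′` of `λ̄′ = Λ(𝒪(Θ′))` at a geometric point `s` pulls back to a witness `π_s^*Θ′` of `π ≫ λ′ ≫ π^∨` (★
`IsLambdaOfAt.pullback_dualIsogeny`, [MumfordAV1970] §23 «`Λ(π^*L) = π̂ Λ(L) π`»); so whenever the H2 files supply the identity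
(b′) `π ≫ λ′ ≫ π^∨ = λ_B^c` (`c = d²/ν` for the Hecke quotient, [MumfordAV1970] §23 Thm. 2), `π_s^*Θ′` witnesses `λ̄_B^c`, and it is
ample when `Θ′` is (`π_s` finite, hence affine: ★ `IsAmple.pullback`).  HC_CM is proved only modulo the 7 printed citations until
rung 0 closes.

* `IsLambdaOfAt.pullback_witness_of_comp_dualIsogeny_eq` — (1): `π ≫ λ′ ≫ π^∨ = λ_c` and a witness `Θ′` of `λ̄′` give the witness
  `π_s^*Θ′` of `λ̄_c`;
* `exists_isAmple_isLambdaOfAt_of_comp_dualIsogeny_eq` — (2): with `Θ′` ample and `π_s` affine, `∃ Θ₀` ample witnessing `λ̄_c`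
  (the (h2) binder with `λ_c := λ_B^c`), and `isAmple_pullback_fibreHom` naming the witness.
* ed. 2: `IsLambdaOfAt.pow_nsmul_of_mulN_comp_eq` and `exists_isAmple_isLambdaOfAt_pow_of_mulN_comp_eq` — the same from the
  MULTIPLIED identity `[n]_B ≫ (π ≫ λ′ ≫ π^∨) = λ_B ≫ [c]_{B̂}` (★ B-p14 `mulN_comp_mulNDesc_comp_comp_dualIsogenyOver`, no
  epi-cancellation of `[n]`): witness `n • π_s^*Θ′` of `λ̄_B^c`.
* ed. 3: `IsLambdaOfAt.pullback_pow_witness_of_comp_eq_comp_mulN` — export (b) `π ≫ λ′ ≫ π^∨ = λ ≫ [ν]` and a witness of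
  `λ̄′` give the witness `π_s^*Θ₀` of `λ̄^ν` (the `H` binder of the (O-y)/(W‴) assemblies; here `π` is the quotient map).

## References
* [MumfordAV1970] D. Mumford, *Abelian Varieties* (1970), §23 (Thm. 2, p. 231).
* [MumfordFogartyKirwan1994] D. Mumford, J. Fogarty, F. Kirwan, *Geometric Invariant Theory* (3rd ed., 1994), Ch. 6 §2
  Definition 6.2–6.3 (p. 120) and (6.3) (p. 121).
* [Hartshorne1977] R. Hartshorne, *Algebraic Geometry* (1977), III Ex. 5.7 (d) (ampleness under finite pull-back).
-/

noncomputable section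

open CategoryTheory CategoryTheory.Limits AlgebraicGeometry MonoidalCategory

universe u

namespace Literature.AlgebraicGeometry.AbelianSchemes

open Literature.AlgebraicGeometry.Motives Literature.AlgebraicGeometry.AbelianVarieties
open scoped MonObj

namespace AbelianSchemeOver

variable {S : Scheme.{u}} {B A' : AbelianSchemeOver S} (π : B.X ⟶ A'.X) [IsMonHom π] (DB : B.DualPair) (D' : A'.DualPair)
  {Ω : Type u} [Field Ω] (s : Spec (.of Ω) ⟶ S) [IsDominant (AbelianVariety.Hom.toSchemeHom (fibreHom π s))]
  (lam' : A'.X ⟶ D'.hat.X)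

/-- **(1) The pulled-back witness.**  If `π ≫ λ′ ≫ π^∨ = λ_c` (an identity of `S`-morphisms `B → B̂`, e.g. `λ_c = λ_B^c` from the
Hecke-quotient relations) and `Θ′` witnesses `λ̄′ = Λ(𝒪(Θ′))` at `s`, then `π_s^*Θ′` witnesses `λ̄_c = Λ(𝒪(π_s^*Θ′))` at `s`
(★ `IsLambdaOfAt.pullback_dualIsogeny` rewritten along the identity). [cite: MumfordAV1970, §23 (Thm. 2, p. 231)]
[cite: MumfordFogartyKirwan1994, Ch. 6 §2 Definition 6.2–6.3 (p. 120)] -/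
theorem IsLambdaOfAt.pullback_witness_of_comp_dualIsogeny_eq {lamc : B.X ⟶ DB.hat.X}
    (hb' : π ≫ lam' ≫ DualPair.dualIsogenyOver π DB D' = lamc)
    {Θ' : CartierDivisor (A'.fibre s).toAbelianVariety.X.left} (hΘ' : A'.IsLambdaOfAt s D' lam' Θ') :
    B.IsLambdaOfAt s DB lamc (Θ'.pullback (AbelianVariety.Hom.toSchemeHom (fibreHom π s))) :=
  hb' ▸ IsLambdaOfAt.pullback_dualIsogeny π DB D' s lam' Θ' hΘ'

/-- **`π_s^*Θ′` is ample when `Θ′` is** and `π_s` is affine (a finite isogeny; ★ `IsAmple.pullback`).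
[cite: Hartshorne1977, III Ex. 5.7 (d)] -/
theorem isAmple_pullback_fibreHom [IsAffineHom (AbelianVariety.Hom.toSchemeHom (fibreHom π s))]
    {Θ' : CartierDivisor (A'.fibre s).toAbelianVariety.X.left} (hΘ' : Θ'.IsAmple) :
    (Θ'.pullback (AbelianVariety.Hom.toSchemeHom (fibreHom π s))).IsAmple :=
  hΘ'.pullback _

/-- **(2) The (h2) binder of the Bezout assembly**: with `π ≫ λ′ ≫ π^∨ = λ_c`, an AMPLE witness `Θ′` of `λ̄′` at `s` and `π_s`
affine, there is an ample witness of `λ̄_c` at `s` — namely `π_s^*Θ′`. [cite: MumfordAV1970, §23 (Thm. 2, p. 231)]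
[cite: MumfordFogartyKirwan1994, Ch. 6 §2 (6.3) (p. 121)] -/
theorem exists_isAmple_isLambdaOfAt_of_comp_dualIsogeny_eq [IsAffineHom (AbelianVariety.Hom.toSchemeHom (fibreHom π s))]
    {lamc : B.X ⟶ DB.hat.X} (hb' : π ≫ lam' ≫ DualPair.dualIsogenyOver π DB D' = lamc)
    {Θ' : CartierDivisor (A'.fibre s).toAbelianVariety.X.left} (hΘ'amp : Θ'.IsAmple) (hΘ' : A'.IsLambdaOfAt s D' lam' Θ') :
    ∃ Θ₀ : CartierDivisor (B.fibre s).toAbelianVariety.X.left, Θ₀.IsAmple ∧ B.IsLambdaOfAt s DB lamc Θ₀ :=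
  ⟨Θ'.pullback (AbelianVariety.Hom.toSchemeHom (fibreHom π s)), isAmple_pullback_fibreHom π s hΘ'amp,
    IsLambdaOfAt.pullback_witness_of_comp_dualIsogeny_eq π DB D' s lam' hb' hΘ'⟩

/-! ### ed. 2 — the MULTIPLIED identity `[n]_B ≫ (π ≫ λ′ ≫ π^∨) = λ_B ≫ [c]_{B̂}` (★ B-p14 `mulN_comp_mulNDesc_comp_comp_dualIsogenyOver`) -/

section Multiplied

variable {B₁ : AbelianSchemeOver S} (D₁ : B₁.DualPair) (s₁ : Spec (.of Ω) ⟶ S)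

/-- **From the multiplied identity to a power witness.**  If `L : B → B̂` is a homomorphism with `[n]_B ≫ L = λ_B ≫ [c]_{B̂}`
(`[m] = mulN m = (𝟙)^m`) and `Θ₀` witnesses `L̄ = Λ(𝒪(Θ₀))` at `s`, then `n • Θ₀` witnesses `λ̄_B^c` at `s`: in the Hom-group
`L^n = [n] ≫ L = λ_B ≫ [c] = λ_B^c` (Mathlib `MonObj.pow_comp`/`comp_pow`), and ★ `IsLambdaOfAt.pow_nsmul`.
[cite: MumfordAV1970, §23 (Thm. 2, p. 231)] [cite: MumfordFogartyKirwan1994, Ch. 6 §2 Definition 6.2–6.3 (p. 120)] -/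
theorem IsLambdaOfAt.pow_nsmul_of_mulN_comp_eq {L lamB : B₁.X ⟶ D₁.hat.X} [IsMonHom L] {n c : ℕ}
    (hmul : B₁.mulN n ≫ L = lamB ≫ D₁.hat.mulN c)
    {Θ₀ : CartierDivisor (B₁.fibre s₁).toAbelianVariety.X.left} (hL : B₁.IsLambdaOfAt s₁ D₁ L Θ₀) :
    B₁.IsLambdaOfAt s₁ D₁ (lamB ^ c) (n • Θ₀) := by
  have hpow : L ^ n = lamB ^ c := by
    have h1 : L ^ n = B₁.mulN n ≫ L := by rw [mulN_def, MonObj.pow_comp, Category.id_comp]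
    rw [h1, hmul, mulN_def, MonObj.comp_pow, Category.comp_id]
  exact hpow ▸ IsLambdaOfAt.pow_nsmul B₁ D₁ L s₁ n hL

end Multiplied

/-- **(2′) The (h2) binder from the MULTIPLIED identity** (the honest (b′) of the Hecke quotient, ★
`mulN_comp_mulNDesc_comp_comp_dualIsogenyOver`: `[n]_B ≫ (π ≫ λ′ ≫ π^∨) = λ_B ≫ [c]_{B̂}`, `c = d²`): with `Θ′` an ample
witness of `λ̄′` at `s`, `π_s` affine, `0 < n` and `π^∨` a homomorphism, `n • π_s^*Θ′` is an ample witness of `λ̄_B^c` at `s`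
(★ (1) + `IsLambdaOfAt.pow_nsmul_of_mulN_comp_eq` + ★ `IsAmple.pullback`/`IsAmple.smul`). [cite: MumfordAV1970, §23 (Thm. 2, p. 231)]
[cite: MumfordFogartyKirwan1994, Ch. 6 §2 (6.3) (p. 121)] -/
theorem exists_isAmple_isLambdaOfAt_pow_of_mulN_comp_eq [IsAffineHom (AbelianVariety.Hom.toSchemeHom (fibreHom π s))]
    [IsMonHom lam'] [IsMonHom (DualPair.dualIsogenyOver π DB D')] {lamB : B.X ⟶ DB.hat.X} {n c : ℕ} (hn : 0 < n)
    (hmul : B.mulN n ≫ (π ≫ lam' ≫ DualPair.dualIsogenyOver π DB D') = lamB ≫ DB.hat.mulN c)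
    {Θ' : CartierDivisor (A'.fibre s).toAbelianVariety.X.left} (hΘ'amp : Θ'.IsAmple) (hΘ' : A'.IsLambdaOfAt s D' lam' Θ') :
    ∃ Θ₀ : CartierDivisor (B.fibre s).toAbelianVariety.X.left, Θ₀.IsAmple ∧ B.IsLambdaOfAt s DB (lamB ^ c) Θ₀ :=
  ⟨n • Θ'.pullback (AbelianVariety.Hom.toSchemeHom (fibreHom π s)), (isAmple_pullback_fibreHom π s hΘ'amp).smul hn,
    IsLambdaOfAt.pow_nsmul_of_mulN_comp_eq DB s hmul (IsLambdaOfAt.pullback_dualIsogeny π DB D' s lam' Θ' hΘ')⟩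

/-! ### ed. 3 — export (b) `ψ ≫ λ_B ≫ ψ^∨ = λ′ ≫ [ν]` (★ B-p20 `comp_polarizationDesc_comp_dualIsogenyOver_eq_comp_mulN`) ⇒ the `H` binder -/

/-- **The `H` binder of the (O-y)/(W‴) assemblies**: for a homomorphism `ψ : A′ → B` with `ψ ≫ λ_B ≫ ψ^∨ = λ′ ≫ [ν]_{Â′}`
(export (b) of the quotient polarisation, `[ν] = mulN ν`) and a witness `Θ₀` of `λ̄_B` at `t`, the pull-back `ψ_t^*Θ₀`
witnesses `λ̄′^ν` at `t` (★ (1) with `λ_c := λ′^ν`, `λ′ ≫ [ν] = λ′^ν` by Mathlib `MonObj.comp_pow`).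
[cite: MumfordAV1970, §23 (Thm. 2, p. 231)] [cite: MumfordFogartyKirwan1994, Ch. 6 §2 (6.3) (p. 121)] -/
theorem IsLambdaOfAt.pullback_pow_witness_of_comp_eq_comp_mulN {lam : B.X ⟶ DB.hat.X} {ν : ℕ}
    (hb : π ≫ lam' ≫ DualPair.dualIsogenyOver π DB D' = lam ≫ DB.hat.mulN ν)
    {Θ₀ : CartierDivisor (A'.fibre s).toAbelianVariety.X.left} (hΘ₀ : A'.IsLambdaOfAt s D' lam' Θ₀) :
    B.IsLambdaOfAt s DB (lam ^ ν) (Θ₀.pullback (AbelianVariety.Hom.toSchemeHom (fibreHom π s))) := by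
  have h : lam ≫ DB.hat.mulN ν = lam ^ ν := by rw [mulN_def, MonObj.comp_pow, Category.comp_id]
  exact IsLambdaOfAt.pullback_witness_of_comp_dualIsogeny_eq π DB D' s lam' (hb.trans h) hΘ₀

end AbelianSchemeOver

end Literature.AlgebraicGeometry.AbelianSchemes
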